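import Literature.Barriers.QuantumFields.MigdalKadanoffGroupBlindness
import Literature.Barriers.QuantumFields.AbelianDeconfinementD4Reduction
import HarnessLib

/-!
# Barrier `MigdalKadanoffGroupBlindness`: the `U(1)` test of the Migdal–Kadanoff comparison criterion, reduced to printed theorems (proofs only)

Proof companion of `Literature/Barriers/QuantumFields/MigdalKadanoffGroupBlindness.lean`
(barrier catalogue D-0021, summit `QuantumFields`, conjunct `YangMills`). The parent file defines
the TECHNIQUE CLASS `Literature.Barriers.QuantumFields.MKConfinementCriterionU1D4` — the `U(1)₄`
instance of "the Migdal–Kadanoff flow of the model reaches the strong-coupling fixed point ⇒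
every infinite-volume limit state has the Wilson-loop area law", false by design — and proves
its negation `MigdalKadanoffGroupBlindness.not_mkConfinementCriterionU1D4` from three hypotheses:
Ito's theorem for compact QED₄ (the named fact
`Literature.Barriers.QuantumFields.MigdalKadanoffGroupBlindness`), the weak-coupling perimeter
law of `U(1)₄` (`Literature.Barriers.QuantumFields.AbelianDeconfinementD4`), and non-emptiness of
the sets of infinite-volume limit points (`hne`). This file declares no definition and no named
fact; it PROVES:

* `MigdalKadanoffGroupBlindness.not_mkConfinementCriterionU1D4_of_abelianDeconfinement`: the
  hypothesis `hne` is discharged by the tree theorem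
  `Literature.MathematicalPhysics.QuantumLattice.infiniteVolumeLimitPoints_nonempty_holds`
  (compactness of the space of probability measures on `U(1)^{edges(ℤ⁴)}`);
* `MigdalKadanoffGroupBlindness.not_mkConfinementCriterionU1D4_of_frohlichSpencer`: hence
  `¬ MKConfinementCriterionU1D4` follows from exactly two printed theorems — Ito 1985 (its `U(1)`
  half, `MigdalKadanoffGroupBlindness`) and the Fröhlich–Spencer 1982 / Guth 1980 free-boundary
  perimeter law `Literature.MathematicalPhysics.QuantumFieldTheory.FrohlichSpencerU1PerimeterLawD4`
  (through `AbelianDeconfinementD4_of_frohlichSpencer`, which uses Ginibre's inequality as proved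
  in the tree);
* `MKConfinementCriterionU1D4.not_migdalKadanoffGroupBlindness_and_frohlichSpencer`: the
  contrapositive — a proof of the technique class (a would-be `MKConfinementCriterionU1D4_holds`)
  refutes the conjunction of those two printed theorems. This is the formal content of
  Ito–Seiler 2009 §3, "the original comparison argument given by Tomboulis has to fail for
  `U(1)`, because the `4D` `U(1)` model has vanishing string tension for sufficiently weak
  coupling", and §5, "for `r = 1` the common interpolation parameter `α*` cannot exist, because
  it would imply the existence of a nonvanishing string tension at all values of the bare
  coupling, in contradiction with proven facts ([guth,fs])";
* `MigdalKadanoffGroupBlindness.exists_misleading_threshold_of_frohlichSpencer`: the threshold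
  form — under the two printed theorems there is `β₁ > 0` beyond which the MK flow of compact
  QED₄ reaches strong coupling, the set of infinite-volume limit states is inhabited, and none of
  them has the area law.

Consequently no theorem `MKConfinementCriterionU1D4_holds : MKConfinementCriterionU1D4` can be
added to a consistent tree in which Ito's theorem and the Fröhlich–Spencer perimeter law hold:
the declaration is a technique class to be refuted, not a fact to be discharged (parent file,
docstring of `MKConfinementCriterionU1D4`: "A technique class (false by design), not an
assertion of the sources").

## References

* K. R. Ito, E. Seiler, *Critical discussion of Tomboulis's approach to the confinement
  problem*, PoS Confinement8 (2008) 034, arXiv:0901.4246 (`ItoSeiler2009Critical`) — §1, §3, §5.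
* K. R. Ito, Phys. Rev. Lett. 55 (1985) 558; Phys. Rev. Lett. 54 (1985) 2383 — through the
  parent file's named fact `MigdalKadanoffGroupBlindness`.
* J. Fröhlich, T. Spencer, Comm. Math. Phys. 83 (1982) 411; A. H. Guth, Phys. Rev. D 21 (1980)
  2291 — through `FrohlichSpencerU1PerimeterLawD4` (`U1WeakCouplingD4.lean`).
-/

noncomputable section

open Literature.MathematicalPhysics.QuantumLattice Literature.MathematicalPhysics.QuantumFieldTheory
open Literature.Barriers.QuantumFields.MigdalKadanoff

namespace Literature.Barriers.QuantumFields

/-- **The `U(1)` test with the non-emptiness hypothesis discharged.** Ito's theorem for compact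
QED₄ (`MigdalKadanoffGroupBlindness`) and the weak-coupling perimeter law
(`AbelianDeconfinementD4`) refute the Migdal–Kadanoff comparison criterion
`MKConfinementCriterionU1D4`; the sets of infinite-volume limit points of the torus Wilson states
of `U(1)₄` are inhabited by the tree theorem `infiniteVolumeLimitPoints_nonempty_holds`
(compactness). [cite: ItoSeiler2009Critical, §3] -/
theorem MigdalKadanoffGroupBlindness.not_mkConfinementCriterionU1D4_of_abelianDeconfinement
    (hI : MigdalKadanoffGroupBlindness) (hA : AbelianDeconfinementD4) :
    ¬ MKConfinementCriterionU1D4 :=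
  hI.not_mkConfinementCriterionU1D4' hA (infiniteVolumeLimitPoints_nonempty_holds (d := 4) u1Rep)

/-- **The `U(1)` test from the two printed theorems.** Ito's theorem for compact QED₄
(`MigdalKadanoffGroupBlindness`: the standard MK flow of the `U(1)` Wilson weight reaches the
strong-coupling fixed point for every `β > 0`) together with the Fröhlich–Spencer / Guth
free-boundary perimeter law (`FrohlichSpencerU1PerimeterLawD4`) refutes
`MKConfinementCriterionU1D4` — "the original comparison argument given by Tomboulis has to fail
for `U(1)`, because the `4D` `U(1)` model has vanishing string tension for sufficiently weak
coupling." The passage from the free-boundary perimeter law to every torus limit point is the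
tree theorem `AbelianDeconfinementD4_of_frohlichSpencer` (Ginibre comparison, proved in the
tree). [cite: ItoSeiler2009Critical, §3 and §5] -/
theorem MigdalKadanoffGroupBlindness.not_mkConfinementCriterionU1D4_of_frohlichSpencer
    (hI : MigdalKadanoffGroupBlindness) (hFS : FrohlichSpencerU1PerimeterLawD4) :
    ¬ MKConfinementCriterionU1D4 :=
  hI.not_mkConfinementCriterionU1D4_of_abelianDeconfinement
    (AbelianDeconfinementD4_of_frohlichSpencer hFS)

/-- **Contrapositive: the technique class refutes a printed theorem.** If the Migdal–Kadanoff
comparison criterion held for `U(1)₄` (a would-be `MKConfinementCriterionU1D4_holds`), then Ito's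
theorem for compact QED₄ and the Fröhlich–Spencer perimeter law could not both hold — "for
`r = 1` the common interpolation parameter `α*` cannot exist, because it would imply the
existence of a nonvanishing string tension at all values of the bare coupling, in contradiction
with proven facts ([guth,fs])." [cite: ItoSeiler2009Critical, §5] -/
theorem MKConfinementCriterionU1D4.not_migdalKadanoffGroupBlindness_and_frohlichSpencer
    (hC : MKConfinementCriterionU1D4) :
    ¬ (MigdalKadanoffGroupBlindness ∧ FrohlichSpencerU1PerimeterLawD4) := fun h =>
  h.1.not_mkConfinementCriterionU1D4_of_frohlichSpencer h.2 hC

/-- The same contrapositive, curried: under Ito's theorem, the technique class negates the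
Fröhlich–Spencer perimeter law. [cite: ItoSeiler2009Critical, §5] -/
theorem MKConfinementCriterionU1D4.not_frohlichSpencer (hC : MKConfinementCriterionU1D4)
    (hI : MigdalKadanoffGroupBlindness) : ¬ FrohlichSpencerU1PerimeterLawD4 := fun hFS =>
  hC.not_migdalKadanoffGroupBlindness_and_frohlichSpencer ⟨hI, hFS⟩

/-- **Threshold form, from the two printed theorems.** Under Ito's theorem for compact QED₄ and
the Fröhlich–Spencer perimeter law there is `β₁ > 0` such that for every `β > β₁` both premises
of the criterion hold and its conclusion fails in an inhabited set of states: the MK flow of the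
`U(1)` Wilson weight reaches the strong-coupling fixed point, the set of infinite-volume limit
states of the torus Wilson states is non-empty, and no such state has the area law — the MK
recursion "signals confinement for these models, and is therefore misleading for the abelian
model, which is known to have a deconfining transition [guth, fs]."
[cite: ItoSeiler2009Critical, §1 and §3] -/
theorem MigdalKadanoffGroupBlindness.exists_misleading_threshold_of_frohlichSpencer
    (hI : MigdalKadanoffGroupBlindness) (hFS : FrohlichSpencerU1PerimeterLawD4) :
    ∃ β₁ : ℝ, 0 < β₁ ∧ ∀ β : ℝ, β₁ < β →
      FlowsToStrongCoupling (u1WilsonCoeff β) ∧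
        (infiniteVolumeLimitPoints (d := 4) u1Rep β).Nonempty ∧
        ∀ μ ∈ infiniteVolumeLimitPoints (d := 4) u1Rep β, ¬ HasAreaLawState μ u1Character := by
  obtain ⟨β₁, hβ₁, hβ⟩ :=
    hI.exists_misleading_threshold (AbelianDeconfinementD4_of_frohlichSpencer hFS)
  exact ⟨β₁, hβ₁, fun β hb => ⟨(hβ β hb).1,
    nonempty_of_infiniteVolumeLimitPoints_nonempty
      (infiniteVolumeLimitPoints_nonempty_holds (d := 4) u1Rep) β, (hβ β hb).2⟩⟩

end Literature.Barriers.QuantumFields
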